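import Literature.Probability.Percolation.ComplementPatternCounts
import HarnessLib

/-!
# Closed clusters of the terminals, the cluster flip `μ_t`, and open reach avoiding a closed cluster — DEFINITIONS

Crux `stmt-CriticalPhenomena-4575`, route `PercNearOneGluingNoHeavy`, 3-point CPI₂ fibre line (facecert gen 28; memo
`prim-l12/prim-facecert/FINDING-gen28-CLUSTER-SWAP.md`).  Objects posited by the CLUSTER-SWAP identities of
`…ThreePointCPIClusterSwap` (an exact form of Reimer's inequality for the pair of events `Y = {c ↔ {s,b}}`,
`D = {s ↮ b closed}`, and the resulting reformulation of the 3-point CPI₂ inside `D`).  For a finite multigraph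
`(V, α, ends)`, a terminal `t` and a configuration `z : α → Bool` (vocabulary of
`Literature/Probability/Percolation/ComplementPatternCounts.lean`; the closed graph of `z` is the open graph of
`fun a => !z a`):

* `CReach ends z t v` — `v` lies in the CLOSED CLUSTER `Q_t(z)` of `t` (a closed path `t → v`);
* `QTouch ends t z a` — the label `a` has an endpoint in `V(Q_t(z))`;
* `clusterFlip ends t z` — the CLUSTER FLIP `μ_t(z)`: complement every label with no endpoint in `V(Q_t(z))`, keep the
  labels touching `V(Q_t(z))`; an involution of the cube preserving `Q_t` (`…ThreePointCPIClusterSwap.clusterFlip_clusterFlip`);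
* `avoidQ ends t z` — the open edges of `z` with no endpoint in `V(Q_t(z))`;
* `UReach ends u t z v` — `v` is joined to `u` by an open path of `z` AVOIDING `V(Q_t(z))` (for `u = s`, `t = b` this is
  the set `U_s(z)` of the facecert memos gen 26–28: the open reach of `s` avoiding the closed cluster of `b`).

Definitions only (no theorems, no named facts). [this work]
-/

namespace Summit.CriticalPhenomena.PercolationContinuityZ3.Theorems.ThreePointCPIClusterSwap

open Literature.Probability.Percolation

variable {V α : Type*}

/-- `CReach ends z t v`: `v` lies in the **closed cluster** `Q_t(z)` of the terminal `t`, i.e. `t` is joined to `v`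
by a path of closed labels of `z` (a path of the open graph of the complementary configuration). [this work] -/
def CReach (ends : α → Sym2 V) (z : α → Bool) (t v : V) : Prop :=
  (openGraph (labelledOpen ends fun a => !z a)).Reachable t v

/-- A label **touches** the closed cluster `Q_t(z)` when one of its endpoints lies in it. [this work] -/
def QTouch (ends : α → Sym2 V) (t : V) (z : α → Bool) (a : α) : Prop :=
  ∃ v, v ∈ ends a ∧ CReach ends z t v

open Classical in
/-- The **cluster flip** `μ_t(z)`: complement every label with no endpoint in the closed cluster `Q_t(z)`, keep
the labels touching `Q_t(z)`. It is an involution of the cube preserving `Q_t` (`clusterFlip_clusterFlip`).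
[this work] -/
noncomputable def clusterFlip (ends : α → Sym2 V) (t : V) (z : α → Bool) : α → Bool :=
  fun a => if QTouch ends t z a then z a else !z a

/-- The open edges of `z` **avoiding** the closed cluster of `t`: images of open labels none of whose endpoints
lies in `V(Q_t(z))`. [this work] -/
def avoidQ (ends : α → Sym2 V) (t : V) (z : α → Bool) : BondConfig V :=
  {e | e ∈ labelledOpen ends z ∧ ∀ v, v ∈ e → ¬ CReach ends z t v}

/-- `UReach ends u t z v`: `v` is joined to `u` by an open path of `z` all of whose edges avoid the closed cluster
`Q_t(z)` (for `u = s`, `t = b`: `v ∈ U_s(z)`, the open reach of `s` avoiding `V(Q_b(z))`). [this work] -/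
def UReach (ends : α → Sym2 V) (u t : V) (z : α → Bool) (v : V) : Prop :=
  (openGraph (avoidQ ends t z)).Reachable u v

end Summit.CriticalPhenomena.PercolationContinuityZ3.Theorems.ThreePointCPIClusterSwap
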